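import Literature.AnabelianGeometry.SemiGraphs.TemperedCurveThm65NonVacuity
import Literature.AnabelianGeometry.SemiGraphs.TemperedOrigin
import HarnessLib

/-!
# [SemiAnbd] Thm. 6.5 (i)(ii)(iv) `TemperedDecompositionGroupsHolds` at the principal ORIGIN certificate of the
# genuine §6 model (NV3 sequel)

Mochizuki, *Semi-graphs of anabelioids*, Publ. RIMS **42** (2006) [SemiAnbd], Theorem 6.5 pp. 71–72
[cite: MochizukiSemiAnbd2006, Thm 6.5 pp.71-72].

PROOF-ONLY sequel (abc-iut cell, layer L3, NV lane; seat abc-iut-w6-d055, abc-iut-L3-lead (gen 5) α51 (3)(b))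
of `TemperedOriginGenuineNonVacuity.lean` (p431594) and of abc-iut-w5-d040's NV3
`exists_temperedCurve_thm65_package_genuine` (`TemperedCurveThm65NonVacuity.lean`, p427727): at the genuine
§6 datum `X` of NV3 (`K = ℚ_p`, `Π^temp = G_{ℚ_p} × F̂₂`, one cusp with `D_x = G_{ℚ_p} × îa(Ẑ)`) the five typed
clauses of Thm. 6.5 (i)(ii)(iv) HOLD, hence the printed statement `TemperedOrigin.TemperedDecompositionGroupsHolds`
HOLDS at the PRINCIPAL certificate `Ω := ⟨(· = X)⟩` — a non-empty certificate at which F-1708 is a theorem.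
(The Lem. 6.1 / 6.3 / Thm. 6.6 statements hold at the principal certificate of the twin datum of p425993, whose
clause list exports `CompactSpace Π^temp` — `TemperedOrigin.exists_principal_genuine`; NV3's list does not
re-export compactness, so the two certificates are recorded separately.)  Consistency / non-vacuity evidence
only; not André's `π₁^temp`; typed ≠ proved; no side taken on [IUTchIII] Cor. 3.12.
-/

noncomputable section

namespace Literature.AnabelianGeometry.SemiGraphs

open Literature.AlgebraicGeometry.Frobenioids (IsSlimGroup)

/-- **F-1708 `TemperedDecompositionGroupsHolds` HOLDS at a non-empty certificate**: the principal origin of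
abc-iut-w5-d040's NV3 datum (Thm. 6.5 (i) `DecompDeterminesPoint`, `InertiaDeterminesCusp`; (ii)
`DecompCommensurablyTerminal`, `DecompEqCommensuratorOfOpenInertia`; (iv) `NoncuspidalNotLeCuspidal`, all
proved there), together with the datum's genuine features.  [cite: MochizukiSemiAnbd2006, Thm 6.5 pp.71-72] -/
theorem TemperedOrigin.exists_principal_temperedDecompositionGroupsHolds (p : ℕ) [Fact p.Prime] :
    ∃ (X : TemperedCurve p) (Ω : TemperedOrigin p),
      (∀ Y, Ω.IsHyperbolicCurveOrigin Y ↔ Y = X) ∧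
      X.K = ⊥ ∧ Function.Surjective X.aug ∧ Nonempty X.GroupLevelData ∧ (∃ x : X.Pt, X.IsCusp x) ∧
      (∃ g ∈ X.DeltaTemp, ∃ h ∈ X.DeltaTemp, g * h ≠ h * g) ∧
      IsSlimGroup X.PiTemp ∧ IsSlimGroup X.DeltaTemp ∧
      Ω.TemperedDecompositionGroupsHolds := by
  obtain ⟨X, hK, haug, hGLD, hcusp, hnab, hslimPi, hslimD, h1, h2, h3, h4, h5, -⟩ :=
    exists_temperedCurve_thm65_package_genuine p
  refine ⟨X, ⟨fun Y => Y = X⟩, fun _ => Iff.rfl, hK, haug, hGLD, hcusp, hnab, hslimPi, hslimD, ?_⟩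
  rintro Y rfl
  exact ⟨h1, h2, h3, h4, h5⟩

end Literature.AnabelianGeometry.SemiGraphs

end
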